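import Literature.Geometry.Lorentzian.CauchyHypersurfaceCausalProofs

/-!
# Route SwallowTheDatum · item `SubdataDevelopmentsEmbed` (stmt-FinalStateConjecture-10053) —
# towards the domain of dependence of the sub-datum (`hcauchy`), III: past extension of a
# future-endless timelike curve (time dual of `exists_isEndlessTimelikeCurve_extends_future`)

`LorentzianMetric.exists_isEndlessTimelikeCurve_extends_future`
(`Literature/…/CauchyHypersurfaceCausalProofs.lean`) extends a past-endless future timelike
curve with a greatest parameter to an endless timelike curve, the new points lying in the
chronological future of the top point. This file proves the time dual, by the same
construction read downwards: a future-endless future timelike curve `β` on an interval `D` with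
LEAST parameter `a` is the final part of an endless timelike curve `Δ ⊇ β`, the new points lying
in `I⁻(β a)` — adjoin at `β a` the maximal integral curve, towards the past, of a `C¹` future
timelike field `Y` with `Y(β a) = β'(a)` (`TimeOrientation.exists_contMDiff_isTimelike_eq`,
`IntegralCurve.exists_isPastEndless`), the junction being differentiable by
`hasMFDerivAt_ite_le`. O'Neill 1983, Ch. 14, proof of Lemma 29 with the integral curves of
Prop. 31 (p. 417).

No definition, no named fact.
-/

noncomputable section

open Function Set Filter Topology TopologicalSpace Bundle Manifold
open scoped Manifold ContDiff Topology

namespace Summit.FinalStateConjecture.FinalStateConjecture.Theorems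

namespace SubdataDevelopmentsEmbed

open Literature.Geometry.Lorentzian

section Extend

variable {E : Type*} [NormedAddCommGroup E] [NormedSpace ℝ E] {H : Type*} [TopologicalSpace H]
  {I : ModelWithCorners ℝ E H} {n : ℕ∞ω} {M : Type*} [TopologicalSpace M] [ChartedSpace H M]
  [IsManifold I ∞ M] {g : LorentzianMetric I n M} {τ : TimeOrientation g}

/-- **Past extension of a future-endless timelike curve.** On a Hausdorff, second countable,
finite-dimensional manifold without boundary with a `Cⁿ` (`n ≥ 2`) time-oriented Lorentzian
metric, a future timelike curve `β` on an interval `D` with least element `a`, future endless,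
is the final part of an endless timelike curve `Δ` on `D' ⊇ D`; the new points lie in
`I⁻(β a)`. Time dual of `LorentzianMetric.exists_isEndlessTimelikeCurve_extends_future`
(O'Neill 1983, Ch. 14, proof of Lemma 29, with the maximal integral curves of Prop. 31):
adjoin at `β a`, towards the past, the maximal integral curve of a `C¹` future timelike field
`Y` with `Y(β a) = β'(a)`. -/
theorem exists_isEndlessTimelikeCurve_extends_past [T2Space M] [SecondCountableTopology M]
    [BoundarylessManifold I M] [FiniteDimensional ℝ E] (hn : 2 ≤ n) {β : ℝ → M} {D : Set ℝ}
    {a : ℝ} (hD : D.OrdConnected) (haD : a ∈ D) (hDa : D ⊆ Ici a)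
    (hβ : g.IsFutureTimelikeCurveOn τ β D) (hend : IsFutureEndless β D) :
    ∃ (Δ : ℝ → M) (D' : Set ℝ), g.IsEndlessTimelikeCurve τ Δ D' ∧ D ⊆ D' ∧
      (∀ t ∈ D, Δ t = β t) ∧
      ∀ t ∈ D', t ∉ D → Δ t ∈ g.chronologicalPast τ {β a} := by
  haveI : LocallyCompactSpace M := Manifold.locallyCompact_of_finiteDimensional (M := M) I
  haveI : CompleteSpace E := FiniteDimensional.complete ℝ E
  have hn1 : (1 : ℕ∞ω) ≤ n := le_trans one_le_two hn
  obtain ⟨Y, hY, hYt, hYa⟩ :=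
    τ.exists_contMDiff_isTimelike_eq hn1 (β a) (hβ a haD).2.1 (hβ a haD).2.2
  have hY0 : ∀ x, Y x ≠ 0 := fun x ↦ (hYt x).1.ne_zero
  obtain ⟨Γm, Dm, hDm, hΓma, hΓmint, hΓmend⟩ :=
    IntegralCurve.exists_isPastEndless hY hY0 (β a) a
  obtain ⟨haDm, hDm_sub, hDm_oc⟩ : a ∈ Dm ∧ Dm ⊆ Iic a ∧ OrdConnected Dm := by
    rcases hDm with rfl | ⟨c, hca, rfl⟩
    · exact ⟨self_mem_Iic, Subset.rfl, ordConnected_Iic⟩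
    · exact ⟨right_mem_Ioc.mpr hca, Ioc_subset_Iic_self, ordConnected_Ioc⟩
  have hva : (Y (Γm a) : E) = velocity I β a := by
    rw [show (Y (Γm a) : E) = Y (β a) by rw [hΓma]]
    exact hYa
  set Δ : ℝ → M := fun t ↦ if t ≤ a then Γm t else β t with hΔ_def
  set D' : Set ℝ := D ∪ Dm with hD'_def
  have hΔa : Δ a = β a := by simp only [hΔ_def, if_pos le_rfl, hΓma]
  have hΔ_of_lt : ∀ t, a < t → Δ t = β t := fun t ht ↦ by
    simp only [hΔ_def, if_neg (not_le.mpr ht)]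
  have hΔ_D : ∀ t ∈ D, Δ t = β t := by
    intro t ht
    rcases eq_or_lt_of_le (mem_Ici.mp (hDa ht)) with h | h
    · rw [← h, hΔa]
    · exact hΔ_of_lt t h
  have hΔ_Dm : ∀ t ∈ Dm, Δ t = Γm t := fun t ht ↦ if_pos (hDm_sub ht)
  have hD_le : ∀ t ∈ D', t ≤ a → t ∈ Dm := by
    rintro t (h | h) hta
    · rw [le_antisymm hta (hDa h)]; exact haDm
    · exact h
  have hD_ge : ∀ t ∈ D', a ≤ t → t ∈ D := by
    rintro t (h | h) hat
    · exact h
    · rw [le_antisymm (hDm_sub h) hat]; exact haD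
  refine ⟨Δ, D', ⟨⟨fun x hx y hy z hz ↦ ?_⟩, fun t ht ↦ ?_, ?_, ?_⟩, subset_union_left, hΔ_D, ?_⟩
  · -- `D'` is an interval
    rcases le_or_gt a x with hax | hax
    · have hyD : y ∈ D := hD_ge y hy (hax.trans (hz.1.trans hz.2))
      exact Or.inl (hD.out (hD_ge x hx hax) hyD hz)
    · have hxm : x ∈ Dm := hD_le x hx hax.le
      rcases le_or_gt z a with hza | hza
      · exact Or.inr (hDm_oc.out hxm haDm ⟨hz.1, hza⟩)
      · have hyD : y ∈ D := hD_ge y hy (hza.le.trans hz.2)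
        exact Or.inl (hD.out haD hyD ⟨hza.le, hz.2⟩)
  · -- future timelike at every parameter
    rcases lt_trichotomy t a with hta | rfl | hta
    · have htm : t ∈ Dm := hD_le t ht hta.le
      have h1 : Δ =ᶠ[𝓝 t] Γm := (eventually_lt_nhds hta).mono fun s hs ↦ if_pos hs.le
      have h2 := ((hΓmint t htm).hasMFDerivAt).congr_of_eventuallyEq h1
      exact LorentzianMetric.futureTimelikeAt_of_hasMFDerivAt (hΔ_Dm t htm) h2 (hYt _).1 (hYt _).2
    · -- the junction at `a`
      have h1 : HasMFDerivAt 𝓘(ℝ, ℝ) I Γm t ((1 : ℝ →L[ℝ] ℝ).smulRight (velocity I β t)) := by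
        have := (hΓmint t haDm).hasMFDerivAt
        rwa [hva] at this
      have h2 : HasMFDerivAt 𝓘(ℝ, ℝ) I β t ((1 : ℝ →L[ℝ] ℝ).smulRight (velocity I β t)) :=
        LorentzianMetric.hasMFDerivAt_smulRight_velocity (hβ t haD).1
      have h3 : HasMFDerivAt 𝓘(ℝ, ℝ) I Δ t ((1 : ℝ →L[ℝ] ℝ).smulRight (velocity I β t)) :=
        LorentzianMetric.hasMFDerivAt_ite_le h1 hΓma h2
      exact LorentzianMetric.futureTimelikeAt_of_hasMFDerivAt hΔa h3 (hβ t haD).2.1 (hβ t haD).2.2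
    · have htD : t ∈ D := hD_ge t ht hta.le
      have h1 : Δ =ᶠ[𝓝 t] β := (eventually_gt_nhds hta).mono fun s hs ↦ hΔ_of_lt s hs
      obtain ⟨hd, htl, hfd⟩ := hβ t htD
      exact LorentzianMetric.timelike_of_eventuallyEq h1 hd htl hfd
  · -- future endless
    refine ⟨⟨a, Or.inl haD⟩, fun r hr ↦ hend.2 r ?_⟩
    rw [hasFutureEndpoint_congr_set (Or.inl haD : a ∈ D') haD
      (fun t hat ↦ ⟨fun h ↦ hD_ge t h hat, fun h ↦ Or.inl h⟩)] at hr
    have heq : (fun t : D ↦ Δ t) = fun t : D ↦ β t := funext fun t ↦ hΔ_D t t.2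
    rw [HasFutureEndpoint] at hr ⊢
    rwa [heq] at hr
  · -- past endless
    refine ⟨⟨a, Or.inr haDm⟩, fun r hr ↦ hΓmend.2 r ?_⟩
    rw [hasPastEndpoint_congr_set (Or.inr haDm : a ∈ D') haDm
      (fun t hta ↦ ⟨fun h ↦ hD_le t h hta, fun h ↦ Or.inr h⟩)] at hr
    have heq : (fun t : Dm ↦ Δ t) = fun t : Dm ↦ Γm t := funext fun t ↦ hΔ_Dm t t.2
    rw [HasPastEndpoint] at hr ⊢
    rwa [heq] at hr
  · -- the new points lie in `I⁻(β a)`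
    intro t ht htD
    have hta : t < a := by
      by_contra h
      exact htD (hD_ge t ht (not_lt.mp h))
    have htm : t ∈ Dm := hD_le t ht hta.le
    have hseg : g.IsFutureTimelikeCurveOn τ Γm (Icc t a) := by
      intro s hs
      have hsD : s ∈ Dm := hDm_oc.out htm haDm hs
      exact LorentzianMetric.futureTimelikeAt_of_hasMFDerivAt rfl (hΓmint s hsD).hasMFDerivAt (hYt _).1 (hYt _).2
    rw [hΔ_Dm t htm]
    exact LorentzianMetric.mem_chronologicalPast_of_mem_chronologicalFuture
      ⟨Γm t, rfl, Γm, t, a, hta, hseg, rfl, hΓma⟩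

end Extend

end SubdataDevelopmentsEmbed

end Summit.FinalStateConjecture.FinalStateConjecture.Theorems

end
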